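import Summits.BirchSwinnertonDyer.BirchSwinnertonDyer.Theorems.PrintCFramBottomClassIndexLawFiveLeEisensteinEndStateV18
import Summits.BirchSwinnertonDyer.BirchSwinnertonDyer.Theorems.PrintCFramBottomClassIndexLawFiveLeBernoulliKummerDictionaryStubs
import Summits.BirchSwinnertonDyer.BirchSwinnertonDyer.Theorems.PrintCFramBottomClassIndexLawFiveLeLevelDictionaryAlpha
import HarnessLib

/-!
# Crux `PrintCFram.BottomClassIndexLawFiveLe` (stmt-BirchSwinnertonDyer-20372), line `eisenstein-resource-bdp-line`, registry v19:
# THE END STATE IN TWO FURTHER CURRENCIES — (a) GENERALIZED-BERNOULLI currency (no `p`-adic Dirichlet character `ψ`, `ω` in either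
# research hypothesis: class data `(m, χ_e, ε, k)` of the member and the classical numbers `B_{p−k,χ_e}/(p−k)`, `B_{k,(χ_eε_{K''})~}/k`),
# (b) the crux's own LEVEL binder: B1 covers every member with a `p`-divisible generator (`n ≥ 1`), Kriz–Li-free

Cell `bsd-print-cfram`, seat `bsd-line-cfram-p1` LEAD g11, `--supports stmt-BirchSwinnertonDyer-20372` (helper). THEOREMS ONLY; no
definition, no named fact, no `sorry`. BSD is not proved by any of this; no summit statement is proved by this seat; the crux stays OPEN.

The registry v19 END STATE (`EisensteinEndStateV19.bottomClassIndexLawFiveLe_of_prints4_of_krizLi_of_classFactor_of_cover`; twin here through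
END STATE v18 p669207) reads: crux ⟸ FOUR print facts ∧ Kriz–Li Thm 1.20 ∧ B1 `stub_bsdp_of_classFactor` ∧ C `stub_heegnerField_of_unitClassFactor`,
with B1 and C phrased on an odd Kriz–Li datum `(f, ψ, ω)` (Dirichlet characters with values in `ℚ_p`) and the `p`-adic norms of
`B_{1,ψ⁻¹~}` / `B_{1,(ψε_{K''}ω⁻¹)~}`. Width seat w8 g3 landed the Kummer dictionary (`Literature…BernoulliCharacterTeichmullerCongruence`,
p671219; `KummerDictionary.stubB1_iff_bernoulli` / `stubC_iff_bernoulli`, p673020): B1 and C are KERNEL-EQUIVALENT to statements on the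
member's CLASS DATA `(m, χ_e, ε, k)` (`χ_e` the primitive quadratic twist character mod `m ⊥ p`, `2 ≤ k ≤ p−2`, parity `χ_e(−1)(−1)^k = −1`,
trace form `a_ℓ(W) ≡ ε(ℓ)(ℓ^k + ℓ^{p−k}) (mod p)`, good reduction off `pm`) with the hypotheses `p ∣ B_{p−k,χ_e}/(p−k)` resp.
`p ∤ B_{p−k,χ_e}/(p−k)` and conclusion `p ∤ B_{k,(χ_e↑ε_{K''}↑)~}/k` — decidable rational arithmetic, the currency of the census engines, of
the kit job `Lines/kriz-li-cover-P3-jobspec.md`, and of the printed half-integral-weight ladder (`B_{k,χ_D}/k = −L(1−k,χ_D)`, Cohen's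
`H(k,|D|)`). Width seat w6 g3 landed the (α) half of the LEVEL DICTIONARY end to end (`LevelDictionaryAlpha.norm_bernoulliOnePrim_le_of_level_pos`,
Kriz–Li-free, Mazur–Wiles-free, `L`-value-free). This file composes them with the end state:

* `bottomClassIndexLawFiveLe_of_prints4_of_krizLi_of_bernoulliClassFactor_of_bernoulliCover` — **END STATE v19 in Bernoulli currency**:
  crux ⟸ (FOUR print facts) ∧ (Kriz–Li Thm 1.20) ∧ B1_Bern ∧ C_Bern. RECOMMENDED TEXT for the planner's promoted items (no auxiliary
  `p`-adic characters; premises are finite rational computations per member).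
* `bsdp_of_level_pos_of_stubB1` — **B1 ⊇ {level ≥ 1}, in the crux's binder currency**: granted B1 (registry text), every class member of
  analytic rank one whose generator `P` of `W(ℚ)/tors` is `p`-divisible in `W(ℚ_p)` (`∃ Q, p • Q = P` — the crux's level binder `n ≥ 1`)
  satisfies `BSD_p` — because (α) makes its class factor a non-unit. So the planner's B1 item contains the whole `n ≥ 1` case of C2; the
  complement inside B1 is «level 0 with `Ш[p] ≠ 0` on the aligned model» ((β), w4 g8 / w5 g3, Mazur–Wiles converse).
* `bsdp_of_one_le_level_of_stubB1` — the same with the crux's `p ^ n • Q = W.toPadicPoint p P`, `1 ≤ n` binder shape.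

References: Kriz–Li 2019 Thm. 1.20, §8; Washington Thm 5.11 / Cor 5.13 (Kummer); crux workfiles `Lines/eisenstein_resource_bdp_line.lean` (v19),
`Lines/eisenstein-resource-bdp-line-lead-g11.md`, `…-w8g3-notes.md`, w6 g3 STATUS 22:18Z.
-/

set_option autoImplicit false
-- summit-side namespace `Summit.BirchSwinnertonDyer.BirchSwinnertonDyer.…` (single-conjunct summit, D-0017 layout)
set_option linter.dupNamespace false

noncomputable section

open scoped Classical
open NumberField WeierstrassCurve DirichletCharacter Literature.NumberTheory.LFunctions
  Literature.NumberTheory.EllipticCurves Literature.NumberTheory.EllipticCurves.KrizLi2019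
  Literature.NumberTheory.EllipticCurves.Rank1Residual
open Literature.NumberTheory.Congruences

namespace Summit.BirchSwinnertonDyer.BirchSwinnertonDyer.Theorems.PrintCFram.EisensteinEndStateV19Currencies

open Summit.BirchSwinnertonDyer.BirchSwinnertonDyer.Theorems.PrintCFram
open Summit.BirchSwinnertonDyer.BirchSwinnertonDyer.Theses.UniversalToricDescent
open Summit.BirchSwinnertonDyer.Rank1Residual.X12.O11

/-! ## §1 END STATE v19 in generalized-Bernoulli currency -/

/-- **END STATE v19 of line `eisenstein-resource-bdp-line` in GENERALIZED-BERNOULLI currency.** The crux follows from: (1) `hprints4` —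
FOUR print facts (Hsieh 2014 Thm. A; Liu–Zhang–Zhang 2018; `ToricPublishedInputs`; Burungale–Flach 2024 Cor. 2); (2) `hKL` — Kriz–Li 2019
Thm. 1.20; (3) `hB1` — **B1_Bern**: `BSD_p(W)` for every class member (`W/ℚ` globally minimal with CM, `p ≥ 5` CM-ramified, `r_an = 1`) with
class data `(m, χ_e, ε, k)` whose CLASS FACTOR `B_{p−k,χ_e}/(p−k)` is divisible by `p`; (4) `hC` — **C_Bern**: every such member whose class
factor is a `p`-adic unit has an imaginary quadratic Heegner field `K''` of `N_W` (`d` odd `< −4`) and a Kronecker character `ε_{K''}` with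
`p ∤ B_{k,(χ_e↑ε_{K''}↑)~}/k`. Proof: w8 g3's `KummerDictionary.stubB1_iff_bernoulli.mpr` / `stubC_iff_bernoulli.mpr` turn (3), (4) into
the registry texts B1, C; `C ⟹ B2′` (five lines, as in `EisensteinEndStateV19`); then END STATE v18 (p669207). CONDITIONAL on (1)–(4);
(3) is the OPEN arithmetic residue (BKNO 2026 §1.4), (4) the open number-theoretic one; BSD is not proved by any of this.
[cite: KrizLi2019, Thm. 1.20 (pp. 7–8), §8 (pp. 49–52)] [cite: Washington1997, Thm. 5.11 and Cor. 5.13]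
[cite: BurungaleKobayashiNakamuraOta2026, §1.4 (arXiv:2608.06879 p. 8)] -/
theorem bottomClassIndexLawFiveLe_of_prints4_of_krizLi_of_bernoulliClassFactor_of_bernoulliCover
    (hprints4 :
    Hsieh2014.thmA_exists_isHsiehLFunction_unrPeriod_anyLevel ∧
    LiuZhangZhang2018.thm151_thm153_modularCurve_heegnerVector_additive ∧
    ToricPublishedInputs ∧
    bsdTriple_of_hasCM_of_L_one_ne_zero)
    (hKL : thm120_padicLogHeegner_unit_of_bernoulli)
    (hB1 :
    ∀ (W : WeierstrassCurve ℚ) [W.IsElliptic] [W.IsGloballyMinimal] (p : ℕ) [Fact p.Prime],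
      W.HasCM → CMRamified W p → 5 ≤ p → W.analyticRank = 1 →
      ∀ (m : ℕ) [NeZero m] (χ : DirichletCharacter ℚ_[p] m) (ε : ℕ → ℤ) (k : ℕ),
        m.Coprime p → χ.IsPrimitive → χ.IsQuadratic → (∀ ℓ : ℕ, ℓ.Prime → ℓ ≠ p → χ (ℓ : ZMod m) = (ε ℓ : ℚ_[p])) →
        2 ≤ k → k ≤ p - 2 → χ (-1) * (-1) ^ k = -1 →
        (∀ ℓ : ℕ, ℓ.Prime → ℓ ≠ p →
          ((W.LFunction ℓ : ℤ) : ZMod p) = (ε ℓ : ZMod p) * ((ℓ : ZMod p) ^ k + (ℓ : ZMod p) ^ (p - k))) →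
        (∀ ℓ : ℕ, (hℓ : ℓ.Prime) → ℓ ≠ p → ¬ ℓ ∣ m → (haveI := Fact.mk hℓ; W.HasGoodReductionAtPrime ℓ)) →
        ‖((p - k : ℕ) : ℚ_[p])⁻¹ * generalizedBernoulli (p - k) χ‖ ≤ (p : ℝ)⁻¹ →
        BSDp W p)
    (hC :
    ∀ (W : WeierstrassCurve ℚ) [W.IsElliptic] [W.IsGloballyMinimal] (p : ℕ) [Fact p.Prime], W.HasCM → CMRamified W p → 5 ≤ p →
      W.analyticRank = 1 →
      ∀ (m : ℕ) [NeZero m] (χ : DirichletCharacter ℚ_[p] m) (ε : ℕ → ℤ) (k : ℕ),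
        m.Coprime p → χ.IsPrimitive → χ.IsQuadratic → (∀ ℓ : ℕ, ℓ.Prime → ℓ ≠ p → χ (ℓ : ZMod m) = (ε ℓ : ℚ_[p])) →
        2 ≤ k → k ≤ p - 2 → χ (-1) * (-1) ^ k = -1 →
        (∀ ℓ : ℕ, ℓ.Prime → ℓ ≠ p →
          ((W.LFunction ℓ : ℤ) : ZMod p) = (ε ℓ : ZMod p) * ((ℓ : ZMod p) ^ k + (ℓ : ZMod p) ^ (p - k))) →
        (∀ ℓ : ℕ, (hℓ : ℓ.Prime) → ℓ ≠ p → ¬ ℓ ∣ m → (haveI := Fact.mk hℓ; W.HasGoodReductionAtPrime ℓ)) →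
        ¬ ‖((p - k : ℕ) : ℚ_[p])⁻¹ * generalizedBernoulli (p - k) χ‖ ≤ (p : ℝ)⁻¹ →
        ∃ (K : Type) (_ : Field K) (_ : NumberField K) (εK : DirichletCharacter ℚ_[p] (NumberField.discr K).natAbs),
          IsImaginaryQuadratic K ∧ SatisfiesHeegnerHypothesis (W.conductorNorm ℤ) K ∧ Odd (NumberField.discr K) ∧
          NumberField.discr K < -4 ∧ IsKroneckerCharacterOf K εK ∧
          ¬ ‖(k : ℚ_[p])⁻¹ * @generalizedBernoulli ℚ_[p] _ _
              (changeLevel (dvd_mul_right m (NumberField.discr K).natAbs) χ *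
                changeLevel (dvd_mul_left (NumberField.discr K).natAbs m) εK).conductor ⟨conductor_ne_zero _⟩ k
              (changeLevel (dvd_mul_right m (NumberField.discr K).natAbs) χ *
                changeLevel (dvd_mul_left (NumberField.discr K).natAbs m) εK).primitiveCharacter‖ ≤ (p : ℝ)⁻¹) :
    Summit.BirchSwinnertonDyer.BirchSwinnertonDyer.Theses.PrintCFram.BottomClassIndexLawFiveLe := by
  have hB1ψ := KummerDictionary.stubB1_iff_bernoulli.mpr hB1
  have hCψ := KummerDictionary.stubC_iff_bernoulli.mpr hC
  refine EisensteinEndStateV18.bottomClassIndexLawFiveLe_of_prints4_of_krizLi_of_classFactor_of_noAdmissibleField hprints4 hKL hB1ψ ?_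
  intro W _ _ p _ hCM hram h5 hr f _ ψ ω hodd hω hss hcls hall
  obtain ⟨K, iK, iK', εK, hK, hH, hoddK, hd4, hεK, hfld⟩ := hCψ W p hCM hram h5 hr f ψ ω hodd hω hss hcls
  exact absurd (@hall K iK iK' hK hH hoddK hd4 εK hεK) hfld

/-! ## §2 B1 covers the crux's `n ≥ 1` case (the level dictionary, (α) half, in the crux's binders) -/

/-- **Granted B1 (registry v19 text, hypothesis `hB1`), every class member of analytic rank one with a `p`-DIVISIBLE generator satisfies
`BSD_p`.** For `W/ℚ` globally minimal with CM, `p ≥ 5` CM-ramified, `r_an(W) = 1`, `P ∈ W(ℚ)` non-torsion generating `W(ℚ)` modulo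
torsion, and `∃ Q ∈ W(ℚ_p), p • Q = P` (the crux's level binder `n ≥ 1`): `BSDp W p`. Proof: the class's odd Kriz–Li datum exists
(`KrizLiBinders.exists_krizLiBinders_of_cmRamified`, w5), its class factor is a non-unit by w6 g3's (α) theorem
`LevelDictionaryAlpha.norm_bernoulliOnePrim_le_of_level_pos_of_generator` (Kummer theory of `P` + the unramified dichotomy + the
Herbrand/Stickelberger engines — Kriz–Li-free, Mazur–Wiles-free, `L`-value-free), and B1 applies. So the planner's B1 item CONTAINS the
`n ≥ 1` case of C2; inside B1 the complement is «`n = 0` with `Ш[p] ≠ 0` on the aligned model» ((β)). BSD is not proved by any of this.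
[cite: SilvermanAEC2009, VIII.§2 and X.§4] [cite: KrizLi2019, Thm. 1.20 (p. 8)] -/
theorem bsdp_of_level_pos_of_stubB1
    (hB1 :
    ∀ (W : WeierstrassCurve ℚ) [W.IsElliptic] [W.IsGloballyMinimal] (p : ℕ) [Fact p.Prime],
    W.HasCM → CMRamified W p → 5 ≤ p → W.analyticRank = 1 →
    ∀ (f : ℕ) [NeZero f] (ψ : DirichletCharacter ℚ_[p] f) (ω : DirichletCharacter ℚ_[p] p),
    ψ.Odd → IsTeichmullerCharacter ω →
    (∀ ℓ : ℕ, ℓ.Prime → ¬ (ℓ ∣ p * W.conductorNorm ℤ) →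
    ‖((W.LFunction ℓ : ℤ) : ℚ_[p]) - (ψ (ℓ : ZMod f) + ψ⁻¹ (ℓ : ZMod f) * ω (ℓ : ZMod p))‖ < 1) →
    ‖bernoulliOnePrim ψ⁻¹‖ ≤ (p : ℝ)⁻¹ →
    BSDp W p)
    (W : WeierstrassCurve ℚ) [W.IsElliptic] [W.IsGloballyMinimal] (p : ℕ) [Fact p.Prime]
    (hCM : W.HasCM) (hram : CMRamified W p) (h5 : 5 ≤ p) (hr : W.analyticRank = 1)
    (P : W.toAffine.Point) (hPtor : ¬ IsOfFinAddOrder P)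
    (hgen : ∀ R : W.toAffine.Point, ∃ (k : ℤ) (T : W.toAffine.Point), IsOfFinAddOrder T ∧ R = k • P + T)
    (hlev : ∃ Q : (W.baseChange ℚ_[p]).toAffine.Point, p • Q = W.toPadicPoint p P) :
    BSDp W p := by
  obtain ⟨f, hf, ψ, ω, -, hω, hss, -, -, hodd⟩ := KrizLiBinders.exists_krizLiBinders_of_cmRamified W hCM hram h5
  haveI := hf
  exact hB1 W p hCM hram h5 hr f ψ ω hodd hω hss
    (LevelDictionaryAlpha.norm_bernoulliOnePrim_le_of_level_pos_of_generator p W hCM hram h5 ψ ω hodd hω hss P hPtor hgen hlev)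

/-- **The same with the crux's binder shape `p ^ n • Q = W.toPadicPoint p P`, `1 ≤ n`.** [cite: SilvermanAEC2009, VIII.§2 and X.§4] -/
theorem bsdp_of_one_le_level_of_stubB1
    (hB1 :
    ∀ (W : WeierstrassCurve ℚ) [W.IsElliptic] [W.IsGloballyMinimal] (p : ℕ) [Fact p.Prime],
    W.HasCM → CMRamified W p → 5 ≤ p → W.analyticRank = 1 →
    ∀ (f : ℕ) [NeZero f] (ψ : DirichletCharacter ℚ_[p] f) (ω : DirichletCharacter ℚ_[p] p),
    ψ.Odd → IsTeichmullerCharacter ω →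
    (∀ ℓ : ℕ, ℓ.Prime → ¬ (ℓ ∣ p * W.conductorNorm ℤ) →
    ‖((W.LFunction ℓ : ℤ) : ℚ_[p]) - (ψ (ℓ : ZMod f) + ψ⁻¹ (ℓ : ZMod f) * ω (ℓ : ZMod p))‖ < 1) →
    ‖bernoulliOnePrim ψ⁻¹‖ ≤ (p : ℝ)⁻¹ →
    BSDp W p)
    (W : WeierstrassCurve ℚ) [W.IsElliptic] [W.IsGloballyMinimal] (p : ℕ) [Fact p.Prime]
    (hCM : W.HasCM) (hram : CMRamified W p) (h5 : 5 ≤ p) (hr : W.analyticRank = 1)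
    (P : W.toAffine.Point) (hPtor : ¬ IsOfFinAddOrder P)
    (hgen : ∀ R : W.toAffine.Point, ∃ (k : ℤ) (T : W.toAffine.Point), IsOfFinAddOrder T ∧ R = k • P + T)
    {n : ℕ} (hn : 1 ≤ n) (hlev : ∃ Q : (W.baseChange ℚ_[p]).toAffine.Point, p ^ n • Q = W.toPadicPoint p P) :
    BSDp W p := by
  refine bsdp_of_level_pos_of_stubB1 hB1 W p hCM hram h5 hr P hPtor hgen ?_
  obtain ⟨Q, hQ⟩ := hlev
  refine ⟨p ^ (n - 1) • Q, ?_⟩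
  rw [← mul_nsmul', ← pow_succ', Nat.sub_add_cancel hn, hQ]

end Summit.BirchSwinnertonDyer.BirchSwinnertonDyer.Theorems.PrintCFram.EisensteinEndStateV19Currencies

end
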